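/-
Copyright (c) 2026 the pub-hodgecm-mathlib formalisation cell (harness21).  Prover seat hodgecm-mathlib-K2E3-p25 (g2), HCML Track B «K2-LIT»,
h413 = `stmt-HodgeConjecture-24833`, unit U12 «Characters», PART «RANK» leaf (11-2qs-Id′) → (qs2-ps) «van Dijk₂», brick D119 (CLS₂-fun), FILE 1b (group-generic inputs (b), (c)).
2026-09-04.
-/
import Mathlib.Topology.Algebra.Group.Basic
import Mathlib.Algebra.Group.Conj
import Mathlib.GroupTheory.Subgroup.Centralizer
import Mathlib.Tactic.Group
import HarnessLib

/-!
# K2_E3 road (h413), (qs2-ps) «van Dijk₂», brick D119 (CLS₂-fun), FILE 1b — the generic inputs (b) OPENNESS and (c) COMPACT REPRESENTATIVES of the recipe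
# (★∕📤 FILE 1 `K2E3HyperbolicClassFunRecipe.exists_classFun_of_recipe`) from Harish-Chandra's submersion lemma and from an Iwasawa decomposition

Cell `pub/hodgecm-mathlib` (D-0151), Track B, seat K2E3-p25 (g2).  `--supports stmt-HodgeConjecture-24833 --as helper`; THEOREMS ONLY (no `def`, no instance, no notation,
no `sorry`); Mathlib-only imports.  COUNT-NEUTRAL.  Group-generic versions of ★ `K2E3HyperbolicClassFunOfTorus` §2 (`conj_regular_torus_nhds`) and of the Iwasawa
argument inside its `exists_bound_of_isCompact` (K2E3-p11 (g3), `N = 3`).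

THE MATHEMATICS ([HarishChandra1970, Part I §3 Lemma 19 (Cor.), Lemma 20]; [Rogawski1990, §12.5 p. 182, §4.9 p. 54]).  `G` a topological group, `T ≤ G` a «torus»,
`Reg` a conjugation-invariant «regularity» predicate, open on `T`, such that the centraliser of a regular element of `T` is `T`.
(b) **`conj_regular_nhds_of_centralizer`**: if (Harish-Chandra) for every regular `γ₀` and `O ∈ 𝓝 γ₀` the conjugates `x t x⁻¹` (`t ∈ Z(γ₀) ∩ O`) form a
neighbourhood of `γ₀`, then for `t₀ ∈ T^{reg}`, `c ∈ G`, `V ∈ 𝓝 t₀` the conjugates `x s x⁻¹` (`s ∈ V ∩ T^{reg}`) form a neighbourhood of `c t₀ c⁻¹` (apply (HC) at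
`γ₀ = c t₀ c⁻¹`, `Z(γ₀) = c T c⁻¹`, with `O = c U₀ c⁻¹`, `U₀ ∩ T ⊆ V ∩ T^{reg}`).
(c) **`exists_compact_representatives_of_iwasawa`**: if `G = K₁ · P` (`K₁` compact, `P` closed) with a continuous retraction `proj : P →* T` onto the commutative `T ≤ P`,
then for a compact `K` the elements of `K` conjugate to some `t ∈ T^{reg}` are conjugate to such a `t` inside the compact `C = proj(P ∩ K₁⁻¹ K K₁)`: indeed
`x = c t c⁻¹`, `c = κ b` ⇒ `b t b⁻¹ = κ⁻¹ x κ ∈ P ∩ K₁⁻¹KK₁` and `proj(b t b⁻¹) = t`.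

HONEST LABEL: HC_CM is proved only modulo the 7 printed citations (2 remaining named inputs: hLiu418 = stmt-HodgeConjecture-24832, h413 = stmt-HodgeConjecture-24833) until rung 0
closes; count-neutral helper.

## References
* [HarishChandra1970] Harish-Chandra (notes by G. van Dijk), *Harmonic Analysis on Reductive p-adic Groups*, LNM 162 (1970), Part I §3 Lemma 19 (Cor.), Lemma 20.
* [Rogawski1990] J. D. Rogawski, *Automorphic Representations of Unitary Groups in Three Variables*, Ann. of Math. Stud. 123 (1990), §12.5 p. 182, §4.9 p. 54.
-/

set_option autoImplicit false
set_option linter.dupNamespace false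

noncomputable section

open Set Filter Topology

namespace Summit.HodgeConjecture.HodgeConjecture.Cruxes.H413.K2E3HyperbolicClassFunRecipeInputs

variable {G : Type*} [Group G] [TopologicalSpace G]

/-! ## (b) Openness from Harish-Chandra's lemma and `Z(t₀) = T` -/

/-- **(b) THE BASIC NEIGHBOURHOODS OF A POINT OF `Ω`** from Harish-Chandra's openness at regular points and `Z_G(t₀) = T` (`t₀ ∈ T^{reg}`).
[cite: HarishChandra1970, Part I §3 Lemma 20] [cite: Rogawski1990, §12.5 p. 182] -/
theorem conj_regular_nhds_of_centralizer [ContinuousMul G] {T : Subgroup G} (Reg : G → Prop)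
    (hRegOpen : IsOpen {t : ↥T | Reg (t : G)}) (hRegConj : ∀ c g : G, Reg (c * g * c⁻¹) ↔ Reg g)
    (hcent : ∀ t₀ : ↥T, Reg (t₀ : G) → Subgroup.centralizer ({(t₀ : G)} : Set G) = T)
    (hHC : ∀ γ₀ : G, Reg γ₀ → ∀ O : Set G, O ∈ 𝓝 γ₀ →
      {g : G | ∃ (x : G) (t : ↥(Subgroup.centralizer ({γ₀} : Set G))), (t : G) ∈ O ∧ g = x * (t : G) * x⁻¹} ∈ 𝓝 γ₀)
    (t₀ : ↥T) (hreg₀ : Reg (t₀ : G)) (c : G) {V : Set ↥T} (hV : V ∈ 𝓝 t₀) :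
    {g : G | ∃ (x : G) (s : ↥T), s ∈ V ∧ s ∈ {t : ↥T | Reg (t : G)} ∧ g = x * (s : G) * x⁻¹} ∈ 𝓝 (c * (t₀ : G) * c⁻¹) := by
  -- shrink `V` to an open subset of `T^{reg}`, the trace of an open `U₀ ⊆ G`
  have hV' : V ∩ {t : ↥T | Reg (t : G)} ∈ 𝓝 t₀ := inter_mem hV (hRegOpen.mem_nhds hreg₀)
  obtain ⟨OM, hOMsub, hOMopen, ht₀OM⟩ := mem_nhds_iff.1 hV'
  obtain ⟨U₀, hU₀open, hU₀eq⟩ := isOpen_induced_iff.1 hOMopen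
  set γ₀ : G := c * (t₀ : G) * c⁻¹ with hγ₀
  have hconjc : Continuous fun g : G => c⁻¹ * g * c := by fun_prop
  have hOopen : IsOpen ((fun g : G => c⁻¹ * g * c) ⁻¹' U₀) := hU₀open.preimage hconjc
  have ht₀U₀ : (t₀ : G) ∈ U₀ := by
    have h1 : t₀ ∈ Subtype.val ⁻¹' U₀ := hU₀eq ▸ ht₀OM
    exact mem_preimage.1 h1
  have hγ₀O : γ₀ ∈ (fun g : G => c⁻¹ * g * c) ⁻¹' U₀ := by
    refine mem_preimage.2 ?_
    have he : c⁻¹ * γ₀ * c = (t₀ : G) := by rw [hγ₀]; group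
    rw [he]; exact ht₀U₀
  have hγ₀reg : Reg γ₀ := by rw [hγ₀]; exact (hRegConj c _).2 hreg₀
  refine mem_of_superset (hHC γ₀ hγ₀reg _ (hOopen.mem_nhds hγ₀O)) ?_
  rintro g ⟨x, t, htO, rfl⟩
  -- `s₀ := c⁻¹ t c ∈ Z(t₀) = T`, `s₀ ∈ U₀ ∩ T ⊆ V ∩ T^{reg}`
  have htc : γ₀ * (t : G) = (t : G) * γ₀ := (Subgroup.mem_centralizer_iff.1 t.2) γ₀ (mem_singleton γ₀)
  have hs₀Z : c⁻¹ * (t : G) * c ∈ Subgroup.centralizer ({(t₀ : G)} : Set G) := by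
    rw [Subgroup.mem_centralizer_iff]
    intro h hh
    rw [mem_singleton_iff.1 hh]
    have ht₀c : (t₀ : G) = c⁻¹ * γ₀ * c := by rw [hγ₀]; group
    rw [ht₀c]
    calc c⁻¹ * γ₀ * c * (c⁻¹ * (t : G) * c) = c⁻¹ * (γ₀ * (t : G)) * c := by group
      _ = c⁻¹ * ((t : G) * γ₀) * c := by rw [htc]
      _ = c⁻¹ * (t : G) * c * (c⁻¹ * γ₀ * c) := by group
  rw [hcent t₀ hreg₀] at hs₀Z
  have hs₀OM : (⟨c⁻¹ * (t : G) * c, hs₀Z⟩ : ↥T) ∈ OM := by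
    rw [← hU₀eq]; exact htO
  obtain ⟨hs₀V, hs₀reg⟩ := hOMsub hs₀OM
  refine ⟨x * c, ⟨c⁻¹ * (t : G) * c, hs₀Z⟩, hs₀V, hs₀reg, ?_⟩
  show x * (t : G) * x⁻¹ = x * c * (c⁻¹ * (t : G) * c) * (x * c)⁻¹
  group

/-! ## (c) Compact representatives from an Iwasawa decomposition -/

/-- **(c) THE CLASSES MEETING A COMPACT SET HAVE REGULAR TORUS REPRESENTATIVES IN A COMPACT SET**, from `G = K₁ P`, a continuous retraction `proj : P →* T` and the
commutativity of `T`. [cite: HarishChandra1970, Part I §3 Lemma 19 (Cor.)] [cite: Rogawski1990, §4.9 p. 54] -/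
theorem exists_compact_representatives_of_iwasawa [IsTopologicalGroup G] {T P : Subgroup G} (hTP : T ≤ P) (hPcl : IsClosed (P : Set G))
    (proj : ↥P →* ↥T) (hproj : Continuous proj) (hprojT : ∀ p : ↥P, (p : G) ∈ T → ((proj p : ↥T) : G) = p)
    (hTcomm : ∀ s t : ↥T, s * t = t * s) {K₁ : Set G} (hK₁ : IsCompact K₁) (hIw : ∀ c : G, ∃ κ ∈ K₁, ∃ b : ↥P, c = κ * (b : G))
    (R : Set ↥T) {K : Set G} (hK : IsCompact K) :
    ∃ C : Set ↥T, IsCompact C ∧ ∀ x ∈ K, x ∈ {x : G | ∃ t : ↥T, t ∈ R ∧ IsConj (t : G) x} → ∃ t ∈ C, t ∈ R ∧ IsConj (t : G) x := by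
  have hK'c : IsCompact ((fun p : G × G => p.1⁻¹ * p.2 * p.1) '' (K₁ ×ˢ K)) := (hK₁.prod hK).image (by fun_prop)
  have hSc : IsCompact {b : ↥P | (b : G) ∈ (fun p : G × G => p.1⁻¹ * p.2 * p.1) '' (K₁ ×ˢ K)} :=
    hPcl.isClosedEmbedding_subtypeVal.isCompact_preimage hK'c
  refine ⟨proj '' {b : ↥P | (b : G) ∈ (fun p : G × G => p.1⁻¹ * p.2 * p.1) '' (K₁ ×ˢ K)}, hSc.image hproj, ?_⟩
  rintro x hx ⟨t, hreg, hconj⟩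
  obtain ⟨c, hc⟩ := isConj_iff.1 hconj
  refine ⟨t, ?_, hreg, hconj⟩
  -- Iwasawa: `c = κ b`; the element `b t b⁻¹ ∈ P`
  obtain ⟨κ, hκ, b, hcb⟩ := hIw c
  let tP : ↥P := ⟨(t : G), hTP t.2⟩
  have hgoal : κ⁻¹ * x * κ = (b : G) * (t : G) * (b : G)⁻¹ := by
    rw [← hc, hcb]
    group
  refine ⟨b * tP * b⁻¹, ?_, ?_⟩
  · refine ⟨(κ, x), ⟨hκ, hx⟩, ?_⟩
    show κ⁻¹ * x * κ = ((b * tP * b⁻¹ : ↥P) : G)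
    rw [hgoal, Subgroup.coe_mul, Subgroup.coe_mul, Subgroup.coe_inv]
  · have hpt : proj tP = t := Subtype.ext (hprojT tP t.2)
    rw [map_mul, map_mul, hpt, hTcomm (proj b) t, mul_assoc, ← map_mul, mul_inv_cancel, map_one, mul_one]

end Summit.HodgeConjecture.HodgeConjecture.Cruxes.H413.K2E3HyperbolicClassFunRecipeInputs

end
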